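import Literature.AlgebraicGeometry.Motives.HodgeStructure
import Mathlib.LinearAlgebra.LinearIndependent.Lemmas
import Mathlib.LinearAlgebra.Basis.Basic
import HarnessLib

/-!
# A conjugation-stable subspace of `V_ℂ` is spanned by its real vectors and has a real basis

For a `ℚ`-vector space `V`, `V_ℂ = ℂ ⊗_ℚ V` carries the real structure `conj = conj ⊗ id` (the
tree's `HodgeStructure.conj`, Deligne, *Théorie de Hodge II*, 2.1.4). A `ℂ`-subspace `W ⊆ V_ℂ` with
`conj W ⊆ W` is "defined over `ℝ`": it is the `ℂ`-span of its `conj`-fixed vectors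
(`span_conjFixed_eq`: `x = ½(x + conj x) - (i/2)·(i(x - conj x))`, both summands real), hence admits a
`ℂ`-basis of real vectors (`exists_basis_conj_eq_self`). (Deligne, Hodge II, 2.1.4–2.1.5 / LNM 900 I
§1: real structures and subspaces defined over `ℝ`; Bourbaki, *Algèbre* II §8 no. 5, rationality of
subspaces for a field extension with a group of automorphisms.)

Use (cell `pub-hodge-ring2`, Literature lane, real-multiplication programme R2a): real bases of the
eigenblocks `T_σ` (`σ` a REAL character of a totally real `End_Hdg`) in which the blocks of the
rational operators `X ∈ Lie Hdg` are REAL `2 × 2` matrices — the `F = ℝ` form of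
`RepresentationTheory/GeneralLinear/Sl2PlacesRationalHull`. Research context: a route conditional on
HC_CM; this file is unconditional linear algebra and no step towards a summit statement. No
definition, no named fact (D-0026); axioms standard.

## References

* [DeligneHodgeII1971] P. Deligne, *Théorie de Hodge II*, Publ. Math. IHÉS 40 (1971), 2.1.4–2.1.5
  (real structure `conj` on `V_ℂ`; subobjects defined over `ℝ`). [cite: DeligneHodgeII1971, 2.1.4–2.1.5]
* [Deligne1982HodgeCycles] P. Deligne, LNM 900 (1982), I §1. [cite: Deligne1982HodgeCycles, I §1]
-/

noncomputable section

open scoped TensorProduct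

namespace Literature.AlgebraicGeometry.Motives

namespace HodgeStructure

universe u

variable {V : Type u} [AddCommGroup V] [Module ℚ V]

/-- `x + conj x` is real. [cite: DeligneHodgeII1971, 2.1.4] -/
theorem conj_add_conj_self (x : ℂ ⊗[ℚ] V) : conj (x + conj x) = x + conj x := by
  rw [map_add, conj_conj, add_comm]

/-- `i · (x - conj x)` is real. [cite: DeligneHodgeII1971, 2.1.4] -/
theorem conj_I_smul_sub_conj (x : ℂ ⊗[ℚ] V) :
    conj (Complex.I • (x - conj x)) = Complex.I • (x - conj x) := by
  rw [conj_smul, Complex.conj_I, map_sub, conj_conj, neg_smul, ← smul_neg, neg_sub]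

/-- `x = ½ (x + conj x) - (i/2) · (i (x - conj x))`: every vector is a `ℂ`-combination of two real
vectors. [cite: DeligneHodgeII1971, 2.1.4] -/
theorem eq_real_combination (x : ℂ ⊗[ℚ] V) :
    x = (2⁻¹ : ℂ) • (x + conj x) - ((2⁻¹ : ℂ) * Complex.I) • (Complex.I • (x - conj x)) := by
  have h1 : ((2⁻¹ : ℂ) * Complex.I) • (Complex.I • (x - conj x)) = -((2⁻¹ : ℂ) • (x - conj x)) := by
    rw [smul_smul, mul_assoc, Complex.I_mul_I, mul_neg_one, neg_smul]
  rw [h1, sub_neg_eq_add, ← smul_add,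
    show x + conj x + (x - conj x) = (2 : ℂ) • x by rw [two_smul]; abel, smul_smul,
    inv_mul_cancel₀ (two_ne_zero : (2 : ℂ) ≠ 0), one_smul]

/-- **A `conj`-stable `ℂ`-subspace of `V_ℂ` is the `ℂ`-span of its real vectors.**
[cite: DeligneHodgeII1971, 2.1.4–2.1.5] -/
theorem span_conjFixed_eq (W : Submodule ℂ (ℂ ⊗[ℚ] V)) (hW : ∀ x ∈ W, conj x ∈ W) :
    Submodule.span ℂ {x | x ∈ W ∧ conj x = x} = W := by
  refine le_antisymm (Submodule.span_le.2 fun x hx => hx.1) fun x hx => ?_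
  rw [eq_real_combination x]
  refine Submodule.sub_mem _ (Submodule.smul_mem _ _ (Submodule.subset_span ⟨?_, conj_add_conj_self x⟩))
    (Submodule.smul_mem _ _ (Submodule.subset_span ⟨?_, conj_I_smul_sub_conj x⟩))
  · exact W.add_mem hx (hW x hx)
  · exact W.smul_mem _ (W.sub_mem hx (hW x hx))

/-- **A `conj`-stable `ℂ`-subspace of `V_ℂ` has a `ℂ`-basis of real vectors** (extract a basis
from the spanning set of real vectors). [cite: DeligneHodgeII1971, 2.1.4–2.1.5] -/
theorem exists_basis_conj_eq_self (W : Submodule ℂ (ℂ ⊗[ℚ] V)) (hW : ∀ x ∈ W, conj x ∈ W) :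
    ∃ (ι : Type u) (b : Module.Basis ι ℂ W), ∀ i, conj (b i : ℂ ⊗[ℚ] V) = b i := by
  classical
  obtain ⟨t, ht, hspan, hli⟩ := exists_linearIndependent ℂ {x : ℂ ⊗[ℚ] V | x ∈ W ∧ conj x = x}
  rw [span_conjFixed_eq W hW] at hspan
  -- the family `t → W`
  have htW : ∀ x : t, (x : ℂ ⊗[ℚ] V) ∈ W := fun x => (ht x.2).1
  let f : t → W := fun x => ⟨x, htW x⟩
  have hf : LinearIndependent ℂ f := by
    refine LinearIndependent.of_comp W.subtype ?_
    exact hli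
  have hfspan : ⊤ ≤ Submodule.span ℂ (Set.range f) := by
    rintro ⟨w, hw⟩ -
    have hw' : w ∈ Submodule.span ℂ t := by rw [hspan]; exact hw
    have : Submodule.map W.subtype (Submodule.span ℂ (Set.range f)) = Submodule.span ℂ t := by
      rw [Submodule.map_span]
      congr 1
      ext y
      constructor
      · rintro ⟨_, ⟨x, rfl⟩, rfl⟩; exact x.2
      · intro hy; exact ⟨f ⟨y, hy⟩, ⟨⟨y, hy⟩, rfl⟩, rfl⟩
    rw [← this] at hw'
    obtain ⟨z, hz, hzw⟩ := hw'
    have : z = ⟨w, hw⟩ := Subtype.ext hzw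
    rw [← this]; exact hz
  exact ⟨t, Module.Basis.mk hf hfspan, fun i => by
    rw [Module.Basis.mk_apply]; exact (ht i.2).2⟩

/-- Real vectors with a `ℂ`-linear relation: if `u`, `v` are real and `u + i v = 0` then
`u = 0` and `v = 0`. [cite: DeligneHodgeII1971, 2.1.4] -/
theorem eq_zero_of_add_I_smul_eq_zero {u v : ℂ ⊗[ℚ] V} (hu : conj u = u) (hv : conj v = v)
    (h : u + Complex.I • v = 0) : u = 0 ∧ v = 0 := by
  have h' := congrArg conj h
  rw [map_add, conj_smul, Complex.conj_I, hu, hv, map_zero, neg_smul] at h'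
  -- h : u + I v = 0, h' : u - I v = 0
  have hu0 : (2 : ℂ) • u = 0 := by
    rw [two_smul]
    have := congrArg₂ (· + ·) h h'
    simp only [add_zero] at this
    rw [← this]; abel
  have hu0' : u = 0 := (smul_eq_zero.1 hu0).resolve_left (two_ne_zero : (2 : ℂ) ≠ 0)
  refine ⟨hu0', ?_⟩
  rw [hu0', zero_add, smul_eq_zero] at h
  exact h.resolve_left Complex.I_ne_zero

end HodgeStructure

end Literature.AlgebraicGeometry.Motives

end
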